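import Summits.MatrixMultiplication.OmegaCensus.STPP122RankThreeReflectA

/-!
# (1,2,2)³ in (ℤ/3)³ — the RANK-3 ROOM CERTIFICATE, part B — reflection 2/3 (the tests hold; room from the count)

Cell `pub-omega` (unit `pub-omega-stpp-1-g34`), topic `Summits/MatrixMultiplication/OmegaCensus`.
HONEST FRAMING (verbatim): lottery ticket; floor = certified bounds/negative ranges. Census STRUCTURE bookkeeping (C10 / X-38: the identified
MECHANISM at the cell (3, 27)); nothing here is a bound on `ω`.

REFLECTION, file 2/3: every test of the engine HOLDS for the true third block of a normal-form STPP family (`guardB`, `guardC`, `candOK_true` —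
each failing test would be a non-trivial vanishing STPP word), the uncovered-code count bounds the difference set (`room_bound`), hence
`room_of_rep`: a normal-form family whose block-1 code quadruple is one of the 78 representatives has `#diffSet ≥ 24`, GIVEN the kernel
decision `main_all` (taken as a hypothesis here); and the two-block tests hold for the true block 1 (`twoOK_true`).

References: H. Cohn, R. Kleinberg, B. Szegedy, C. Umans, FOCS 2005 (arXiv:math/0511460), Def. 5.1. Records: HOME `pub-omega-stpp-1-g34/code/rank3/`.
-/

namespace Summit.MatrixMultiplication.OmegaCensus

namespace Rank3Cert

open Finset Pointwise Literature.Computability.AlgebraicComplexity GLNF STPP211Neg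

attribute [local irreducible] E3 g3

variable {B C : Fin 3 → Finset (V 3)} {β₁ β₂ γ₁ γ₂ δ₁ δ₂ ε₁ ε₂ : V 3}

/-! ### The tests hold for the true block 2 -/

/-- All `B`-codes of the three blocks are codes of elements of some `B i` (with the block index). -/
theorem all_B_codes (hB0 : B 0 = {0, e1}) (hB1 : B 1 = {β₁, β₂}) (hB2 : B 2 = {δ₁, δ₂}) {n : ℕ}
    (hn : n ∈ [0, 1, E3.enc β₁, E3.enc β₂, E3.enc δ₁, E3.enc δ₂]) : ∃ i : Fin 3, ∃ t ∈ B i, n = E3.enc t := by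
  simp only [List.mem_cons, List.mem_nil_iff, or_false] at hn
  rcases hn with rfl | rfl | rfl | rfl | rfl | rfl
  · exact ⟨0, 0, by rw [hB0]; simp, enc_zero.symm⟩
  · exact ⟨0, e1, by rw [hB0]; simp, enc_e1.symm⟩
  · exact ⟨1, β₁, by rw [hB1]; simp, rfl⟩
  · exact ⟨1, β₂, by rw [hB1]; simp, rfl⟩
  · exact ⟨2, δ₁, by rw [hB2]; simp, rfl⟩
  · exact ⟨2, δ₂, by rw [hB2]; simp, rfl⟩

/-- The same for the `C`-codes. -/
theorem all_C_codes (hC0 : C 0 = {0, e2}) (hC1 : C 1 = {γ₁, γ₂}) (hC2 : C 2 = {ε₁, ε₂}) {n : ℕ}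
    (hn : n ∈ [0, 3, E3.enc γ₁, E3.enc γ₂, E3.enc ε₁, E3.enc ε₂]) : ∃ k : Fin 3, ∃ u ∈ C k, n = E3.enc u := by
  simp only [List.mem_cons, List.mem_nil_iff, or_false] at hn
  rcases hn with rfl | rfl | rfl | rfl | rfl | rfl
  · exact ⟨0, 0, by rw [hC0]; simp, enc_zero.symm⟩
  · exact ⟨0, e2, by rw [hC0]; simp, enc_e2.symm⟩
  · exact ⟨1, γ₁, by rw [hC1]; simp, rfl⟩
  · exact ⟨1, γ₂, by rw [hC1]; simp, rfl⟩
  · exact ⟨2, ε₁, by rw [hC2]; simp, rfl⟩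
  · exact ⟨2, ε₂, by rw [hC2]; simp, rfl⟩

/-- A code in a four-bit mask `(bit s₁ ∨ bit s₂) ∨ (bit s₃ ∨ bit s₄)` is one of the four. -/
theorem mem_four {s₁ s₂ s₃ s₄ n : ℕ}
    (h : (Nat.lor (Nat.lor (bit s₁) (bit s₂)) (Nat.lor (bit s₃) (bit s₄))).testBit n = true) :
    n = s₁ ∨ n = s₂ ∨ n = s₃ ∨ n = s₄ := by
  simp only [lor_eq, Nat.testBit_lor, Bool.or_eq_true, testBit_bit, decide_eq_true_eq] at h
  rcases h with (h | h) | (h | h)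
  · exact Or.inl h.symm
  · exact Or.inr (Or.inl h.symm)
  · exact Or.inr (Or.inr (Or.inl h.symm))
  · exact Or.inr (Or.inr (Or.inr h.symm))

/-- A two-element set is `{x, y}` with `enc x < enc y`. -/
theorem exists_pair_lt {s : Finset (V 3)} (hs : s.card = 2) : ∃ x y : V 3, s = {x, y} ∧ E3.enc x < E3.enc y := by
  obtain ⟨x, y, hxy, rfl⟩ := card_eq_two.1 hs
  rcases lt_or_gt_of_ne (fun h => hxy (enc_inj h)) with h | h
  · exact ⟨x, y, rfl, h⟩
  · exact ⟨y, x, pair_comm x y, h⟩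

section Tests

variable (hS : IsSTPP (fun _ : Fin 3 => ({0} : Finset (V 3))) B C)
  (hB0 : B 0 = {0, e1}) (hC0 : C 0 = {0, e2}) (hB1 : B 1 = {β₁, β₂}) (hC1 : C 1 = {γ₁, γ₂})
  (hB2 : B 2 = {δ₁, δ₂}) (hC2 : C 2 = {ε₁, ε₂}) (hδ : δ₁ ≠ δ₂) (hε : ε₁ ≠ ε₂)
include hS hB0 hC0 hB1 hC1

/-- Guard on a `B₂`-code: it is not in `S + C_old`. -/
theorem guardB (hB2 : B 2 = {δ₁, δ₂}) {δ : V 3} (hδ : δ = δ₁ ∨ δ = δ₂) :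
    (state g3 (E3.enc β₁, E3.enc β₂, E3.enc γ₁, E3.enc γ₂)).2.2.1.testBit (E3.enc δ) = false := by
  have hδB : δ ∈ B 2 := by rw [hB2]; rcases hδ with rfl | rfl <;> simp
  rw [Bool.eq_false_iff]
  intro h
  change (maskOf (List.flatMap (fun s => List.map (fun c => cadd g3 s c) ([0, 3] ++ [E3.enc γ₁, E3.enc γ₂]))
    (diffs g3 [0, 1] [0, 3] ++ diffs g3 [E3.enc β₁, E3.enc β₂] [E3.enc γ₁, E3.enc γ₂]))).testBit (E3.enc δ) = true at h
  rw [← mem_iff_maskOf, List.mem_flatMap] at h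
  obtain ⟨sc, hs, hm⟩ := h
  rw [List.mem_map] at hm
  obtain ⟨cc, hc, he⟩ := hm
  obtain ⟨j, hj, t, ht, u, hu, rfl⟩ := old_S_codes hB0 hC0 hB1 hC1 hs
  obtain ⟨k, hk, κ, hκ, rfl⟩ := old_C_codes hC0 hC1 (n := cc) (by simpa using hc)
  rw [cadd_enc] at he
  have e := enc_inj he.symm   -- δ = t - u + κ
  have hw := word hS (i := 2) (k := k) (j := j) hδB hκ ht hu (by rw [e]; abel)
  exact hj hw.1.symm

/-- Guard on a `C₂`-code: it is not in `B_old − S`. -/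
theorem guardC (hC2 : C 2 = {ε₁, ε₂}) {ε : V 3} (hε : ε = ε₁ ∨ ε = ε₂) :
    (state g3 (E3.enc β₁, E3.enc β₂, E3.enc γ₁, E3.enc γ₂)).2.2.2.1.testBit (E3.enc ε) = false := by
  have hεC : ε ∈ C 2 := by rw [hC2]; rcases hε with rfl | rfl <;> simp
  rw [Bool.eq_false_iff]
  intro h
  change (maskOf (List.flatMap (fun b => List.map (fun s => g3.sub b s)
    (diffs g3 [0, 1] [0, 3] ++ diffs g3 [E3.enc β₁, E3.enc β₂] [E3.enc γ₁, E3.enc γ₂])) ([0, 1] ++ [E3.enc β₁, E3.enc β₂]))).testBit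
    (E3.enc ε) = true at h
  rw [← mem_iff_maskOf, List.mem_flatMap] at h
  obtain ⟨bc, hb, hm⟩ := h
  rw [List.mem_map] at hm
  obtain ⟨sc, hs, he⟩ := hm
  obtain ⟨i, hi, β, hβ, rfl⟩ := old_B_codes hB0 hB1 (n := bc) (by simpa using hb)
  obtain ⟨j, hj, t, ht, u, hu, rfl⟩ := old_S_codes hB0 hC0 hB1 hC1 hs
  rw [sub_enc] at he
  have e := enc_inj he.symm   -- ε = β - (t - u)
  have hw := word hS (i := i) (k := 2) (j := j) hβ hεC ht hu (by rw [e]; abel)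
  exact hj hw.2.1


/-- **`candOK` holds for the true block 2** (every failing test would be a non-trivial vanishing STPP word). -/
theorem candOK_true (hB2 : B 2 = {δ₁, δ₂}) (hC2 : C 2 = {ε₁, ε₂}) (hδ : δ₁ ≠ δ₂) :
    candOK g3 (state g3 (E3.enc β₁, E3.enc β₂, E3.enc γ₁, E3.enc γ₂)) (E3.enc δ₁) (E3.enc δ₂) (E3.enc ε₁) (E3.enc ε₂) = true := by
  have hδ₁ : δ₁ ∈ B 2 := by rw [hB2]; simp
  have hδ₂ : δ₂ ∈ B 2 := by rw [hB2]; simp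
  have hε₁ : ε₁ ∈ C 2 := by rw [hC2]; simp
  have hε₂ : ε₂ ∈ C 2 := by rw [hC2]; simp
  -- the state components used by candOK
  have hSC : (state g3 (E3.enc β₁, E3.enc β₂, E3.enc γ₁, E3.enc γ₂)).2.1 =
      Nat.lor (maskOf (diffs g3 [0, 1] [0, 3] ++ diffs g3 [E3.enc β₁, E3.enc β₂] [E3.enc γ₁, E3.enc γ₂]))
        (maskOf (diffs g3 [0, 1] [E3.enc γ₁, E3.enc γ₂] ++ diffs g3 [E3.enc β₁, E3.enc β₂] [0, 3])) := rfl
  have hBA : (state g3 (E3.enc β₁, E3.enc β₂, E3.enc γ₁, E3.enc γ₂)).2.2.2.2.1 = maskOf ([0, 1] ++ [E3.enc β₁, E3.enc β₂]) := rfl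
  have hCA : (state g3 (E3.enc β₁, E3.enc β₂, E3.enc γ₁, E3.enc γ₂)).2.2.2.2.2 = maskOf ([0, 3] ++ [E3.enc γ₁, E3.enc γ₂]) := rfl
  simp only [candOK, hSC, hBA, hCA, sub_enc, cadd_enc, Bool.and_eq_true]
  refine ⟨⟨⟨⟨?_, ?_⟩, ?_⟩, ?_⟩, ?_⟩
  · -- TPP: δ₁ − ε₁ ≠ δ₂ − ε₂
    cases hq : Nat.beq (E3.enc (δ₁ - ε₁)) (E3.enc (δ₂ - ε₂)) with
    | false => rfl
    | true => exact absurd (word hS hδ₁ hε₁ hδ₂ hε₂ (enc_inj (Nat.eq_of_beq_eq_true hq))).2.2.1 hδ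
  · cases hq : Nat.beq (E3.enc (δ₁ - ε₂)) (E3.enc (δ₂ - ε₁)) with
    | false => rfl
    | true => exact absurd (word hS hδ₁ hε₂ hδ₂ hε₁ (enc_inj (Nat.eq_of_beq_eq_true hq))).2.2.1 hδ
  · -- S₂ ∩ (S ∪ Cross) = ∅
    apply beq_land_zero
    intro n hn hm
    rw [lor_eq, Nat.testBit_lor, Bool.or_eq_true, ← mem_iff_maskOf, ← mem_iff_maskOf] at hm
    -- n is a diagonal difference of block 2
    have hdiag : ∃ t' ∈ B 2, ∃ u ∈ C 2, n = E3.enc (t' - u) := by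
      rcases mem_four hn with rfl | rfl | rfl | rfl
      · exact ⟨δ₁, hδ₁, ε₁, hε₁, rfl⟩
      · exact ⟨δ₁, hδ₁, ε₂, hε₂, rfl⟩
      · exact ⟨δ₂, hδ₂, ε₁, hε₁, rfl⟩
      · exact ⟨δ₂, hδ₂, ε₂, hε₂, rfl⟩
    obtain ⟨t', ht', u, hu, rfl⟩ := hdiag
    -- m is an old difference (diagonal or cross)
    have hold : ∃ i k : Fin 3, i ≠ 2 ∧ ∃ t ∈ B i, ∃ u' ∈ C k, E3.enc (t' - u) = E3.enc (t - u') := by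
      rcases hm with hm | hm
      · obtain ⟨j, hj, t, ht, u', hu', e⟩ := old_S_codes hB0 hC0 hB1 hC1 hm
        exact ⟨j, j, hj, t, ht, u', hu', e⟩
      · obtain ⟨i, k, hi, -, t, ht, u', hu', e⟩ := old_cross_codes hB0 hC0 hB1 hC1 hm
        exact ⟨i, k, hi, t, ht, u', hu', e⟩
    obtain ⟨i, k, hi, t, ht, u', hu', e⟩ := hold
    have hw := word hS (i := i) (k := k) (j := 2) ht hu' ht' hu (enc_inj e.symm)
    exact hi hw.1
  · -- C_old ∩ (C₂ + {0, ±d}) = ∅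
    apply beq_land_zero
    intro n hn hm
    rw [← mem_iff_maskOf] at hn hm
    obtain ⟨k, hk, κ, hκ, rfl⟩ := old_C_codes hC0 hC1 (n := n) (by simpa using hm)
    -- κ = ε_a + (δ_p − δ_q)
    have key : ∃ εa ∈ C 2, ∃ δp ∈ B 2, ∃ δq ∈ B 2, κ = εa + (δp - δq) := by
      simp only [List.mem_cons, List.mem_nil_iff, or_false] at hn
      rcases hn with h | h | h | h | h | h
      · exact ⟨ε₁, hε₁, δ₁, hδ₁, δ₁, hδ₁, by rw [enc_inj h]; abel⟩
      · exact ⟨ε₂, hε₂, δ₁, hδ₁, δ₁, hδ₁, by rw [enc_inj h]; abel⟩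
      · exact ⟨ε₁, hε₁, δ₂, hδ₂, δ₁, hδ₁, by rw [enc_inj h]⟩
      · exact ⟨ε₁, hε₁, δ₁, hδ₁, δ₂, hδ₂, by rw [enc_inj h]; abel⟩
      · exact ⟨ε₂, hε₂, δ₂, hδ₂, δ₁, hδ₁, by rw [enc_inj h]⟩
      · exact ⟨ε₂, hε₂, δ₁, hδ₁, δ₂, hδ₂, by rw [enc_inj h]; abel⟩
    obtain ⟨εa, hεa, δp, hδp, δq, hδq, e⟩ := key
    have hw := word hS (i := 2) (k := k) (j := 2) hδp hκ hδq hεa (by rw [e]; abel)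
    exact hk hw.2.1.symm
  · -- B_old ∩ (B₂ + {0, ±e}) = ∅
    apply beq_land_zero
    intro n hn hm
    rw [← mem_iff_maskOf] at hn hm
    obtain ⟨i, hi, β, hβ, rfl⟩ := old_B_codes hB0 hB1 (n := n) (by simpa using hm)
    have key : ∃ δa ∈ B 2, ∃ εp ∈ C 2, ∃ εq ∈ C 2, β = δa + (εp - εq) := by
      simp only [List.mem_cons, List.mem_nil_iff, or_false] at hn
      rcases hn with h | h | h | h | h | h
      · exact ⟨δ₁, hδ₁, ε₁, hε₁, ε₁, hε₁, by rw [enc_inj h]; abel⟩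
      · exact ⟨δ₂, hδ₂, ε₁, hε₁, ε₁, hε₁, by rw [enc_inj h]; abel⟩
      · exact ⟨δ₁, hδ₁, ε₂, hε₂, ε₁, hε₁, by rw [enc_inj h]⟩
      · exact ⟨δ₁, hδ₁, ε₁, hε₁, ε₂, hε₂, by rw [enc_inj h]; abel⟩
      · exact ⟨δ₂, hδ₂, ε₂, hε₂, ε₁, hε₁, by rw [enc_inj h]⟩
      · exact ⟨δ₂, hδ₂, ε₁, hε₁, ε₂, hε₂, by rw [enc_inj h]; abel⟩
    obtain ⟨δa, hδa, εp, hεp, εq, hεq, e⟩ := key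
    have hw := word hS (i := i) (k := 2) (j := 2) hβ hεp hδa hεq (by rw [e]; abel)
    exact hi hw.1


omit hS in
/-- **Room from the uncovered count:** if at most 3 codes are missed by the differences `t − u`, the family's difference set has ≥ 24 points. -/
theorem room_bound (hB2 : B 2 = {δ₁, δ₂}) (hC2 : C 2 = {ε₁, ε₂})
    (hm : missing3 g3 (E3.enc β₁, E3.enc β₂, E3.enc γ₁, E3.enc γ₂) (E3.enc δ₁) (E3.enc δ₂) (E3.enc ε₁) (E3.enc ε₂) ≤ 3) :
    24 ≤ (diffSet (fun _ : Fin 3 => ({0} : Finset (V 3))) B C).card := by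
  classical
  set D := maskOf (diffs g3 [0, 1, E3.enc β₁, E3.enc β₂, E3.enc δ₁, E3.enc δ₂] [0, 3, E3.enc γ₁, E3.enc γ₂, E3.enc ε₁, E3.enc ε₂])
    with hD
  have hm' : (codes.filter fun z => !(Nat.testBit D z)).length ≤ 3 := hm
  -- every element whose code is a listed difference lies in the difference set
  have cover : ∀ z : V 3, D.testBit (E3.enc z) = true → z ∈ diffSet (fun _ : Fin 3 => ({0} : Finset (V 3))) B C := by
    intro z hz
    rw [hD, ← mem_iff_maskOf] at hz
    obtain ⟨tc, htc, uc, huc, he⟩ := (mem_diffs (g := g3)).1 hz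
    obtain ⟨i, t, ht, rfl⟩ := all_B_codes hB0 hB1 hB2 htc
    obtain ⟨k, u, hu, rfl⟩ := all_C_codes hC0 hC1 hC2 huc
    rw [sub_enc] at he
    have hz' : z = t - u := enc_inj he
    exact mem_diffSet.2 ⟨i, k, t, ht, 0, mem_singleton_self _, u, hu, 0, mem_singleton_self _, by rw [hz']; abel⟩
  -- count
  set good := (univ : Finset (V 3)).filter fun z => D.testBit (E3.enc z) = true with hgood
  set bad := (univ : Finset (V 3)).filter fun z => ¬ D.testBit (E3.enc z) = true with hbad
  have h27 : good.card + bad.card = 27 := by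
    rw [hgood, hbad, card_filter_add_card_filter_not]; rfl
  have hsub : good ⊆ diffSet (fun _ : Fin 3 => ({0} : Finset (V 3))) B C := fun z hz => cover z (mem_filter.1 hz).2
  have hbad_le : bad.card ≤ 3 := by
    have : (bad.image E3.enc).card = bad.card := card_image_of_injective _ E3.enc_inj
    rw [← this]
    refine le_trans (card_le_card (fun n hn => ?_)) (le_trans (List.toFinset_card_le _) hm')
    obtain ⟨z, hz, rfl⟩ := mem_image.1 hn
    rw [List.mem_toFinset, List.mem_filter]
    refine ⟨List.mem_range.2 (enc_lt z), ?_⟩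
    have hz' := (mem_filter.1 hz).2
    cases hb : D.testBit (E3.enc z)
    · rfl
    · exact absurd hb hz'
  have := card_le_card hsub
  omega


end Tests

/-- **Room for a representative:** a normal-form family whose block-1 code quadruple is one of the 78 representatives has a difference
set of at least 24 points — by the kernel decision `main_all` (here a hypothesis; discharged in the assembly file). -/
theorem room_of_rep (hmain : reps.all (repOK g3 3) = true)
    (hS : IsSTPP (fun _ : Fin 3 => ({0} : Finset (V 3))) B C) (hB0 : B 0 = {0, e1}) (hC0 : C 0 = {0, e2})
    (hB1 : B 1 = {β₁, β₂}) (hC1 : C 1 = {γ₁, γ₂}) (hB2c : (B 2).card = 2) (hC2c : (C 2).card = 2)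
    (hrep : (E3.enc β₁, E3.enc β₂, E3.enc γ₁, E3.enc γ₂) ∈ reps) :
    24 ≤ (diffSet (fun _ : Fin 3 => ({0} : Finset (V 3))) B C).card := by
  obtain ⟨δ₁, δ₂, hB2, hδlt⟩ := exists_pair_lt hB2c
  obtain ⟨ε₁, ε₂, hC2, hεlt⟩ := exists_pair_lt hC2c
  have hδ : δ₁ ≠ δ₂ := fun h => by rw [h] at hδlt; exact lt_irrefl _ hδlt
  have hrepOK := List.all_eq_true.1 hmain _ hrep
  refine room_bound hB0 hC0 hB1 hC1 hB2 hC2 (repOK_extract hrepOK (enc_lt _) (enc_lt _) (enc_lt _) (enc_lt _) hδlt hεlt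
    (guardB hS hB0 hC0 hB1 hC1 hB2 (Or.inl rfl)) (guardB hS hB0 hC0 hB1 hC1 hB2 (Or.inr rfl))
    (guardC hS hB0 hC0 hB1 hC1 hC2 (Or.inl rfl)) (guardC hS hB0 hC0 hB1 hC1 hC2 (Or.inr rfl))
    (candOK_true hS hB0 hC0 hB1 hC1 hB2 hC2 hδ))



/-! ### The two-block tests hold for the true block 1 (against block 0) -/

section TwoBlock

/-- Members of `S₀`'s code list are codes of `t − u`, `t ∈ B₀`, `u ∈ C₀`. -/
theorem S0_codes (hB0 : B 0 = {0, e1}) (hC0 : C 0 = {0, e2}) {n : ℕ} (hn : n ∈ diffs g3 [0, 1] [0, 3]) : ∃ t ∈ B 0, ∃ u ∈ C 0, n = E3.enc (t - u) := by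
  obtain ⟨bc, hb, cc, hc, rfl⟩ := (mem_diffs (g := g3) (B := [0, 1]) (C := [0, 3])).1 hn
  simp only [List.mem_cons, List.mem_nil_iff, or_false] at hb hc
  rcases hb with rfl | rfl <;> rcases hc with rfl | rfl
  · exact ⟨0, by rw [hB0]; simp, 0, by rw [hC0]; simp, by rw [← sub_enc, enc_zero]⟩
  · exact ⟨0, by rw [hB0]; simp, e2, by rw [hC0]; simp, by rw [← sub_enc, enc_zero, enc_e2]⟩
  · exact ⟨e1, by rw [hB0]; simp, 0, by rw [hC0]; simp, by rw [← sub_enc, enc_zero, enc_e1]⟩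
  · exact ⟨e1, by rw [hB0]; simp, e2, by rw [hC0]; simp, by rw [← sub_enc, enc_e1, enc_e2]⟩

/-- Codes `[0,1]` are codes of elements of `B₀`. -/
theorem B0_codes (hB0 : B 0 = {0, e1}) {n : ℕ} (hn : n ∈ [0, 1]) : ∃ t ∈ B 0, n = E3.enc t := by
  simp only [List.mem_cons, List.mem_nil_iff, or_false] at hn
  rcases hn with rfl | rfl
  · exact ⟨0, by rw [hB0]; simp, enc_zero.symm⟩
  · exact ⟨e1, by rw [hB0]; simp, enc_e1.symm⟩

/-- Codes `[0,3]` are codes of elements of `C₀`. -/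
theorem C0_codes (hC0 : C 0 = {0, e2}) {n : ℕ} (hn : n ∈ [0, 3]) : ∃ u ∈ C 0, n = E3.enc u := by
  simp only [List.mem_cons, List.mem_nil_iff, or_false] at hn
  rcases hn with rfl | rfl
  · exact ⟨0, by rw [hC0]; simp, enc_zero.symm⟩
  · exact ⟨e2, by rw [hC0]; simp, enc_e2.symm⟩

/-- **`twoOK` holds for the true block 1** (sorted codes not required here). -/
theorem twoOK_true (hS : IsSTPP (fun _ : Fin 3 => ({0} : Finset (V 3))) B C) (hB0 : B 0 = {0, e1}) (hC0 : C 0 = {0, e2})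
    (hB1 : B 1 = {β₁, β₂}) (hC1 : C 1 = {γ₁, γ₂}) (hβ : β₁ ≠ β₂) : twoOK g3 (E3.enc β₁) (E3.enc β₂) (E3.enc γ₁) (E3.enc γ₂) = true := by
  have hβ₁ : β₁ ∈ B 1 := by rw [hB1]; simp
  have hβ₂ : β₂ ∈ B 1 := by rw [hB1]; simp
  have hγ₁ : γ₁ ∈ C 1 := by rw [hC1]; simp
  have hγ₂ : γ₂ ∈ C 1 := by rw [hC1]; simp
  have h10 : (1 : Fin 3) ≠ 0 := by decide
  -- the guards
  have gB : ∀ {β}, β ∈ B 1 → (maskOf ((diffs g3 [0, 1] [0, 3]).flatMap fun s => [cadd g3 s 0, cadd g3 s 3])).testBit (E3.enc β) = false := by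
    intro β hβm
    rw [Bool.eq_false_iff]; intro h
    rw [← mem_iff_maskOf, List.mem_flatMap] at h
    obtain ⟨sc, hs, hm⟩ := h
    obtain ⟨t, ht, u, hu, rfl⟩ := S0_codes hB0 hC0 hs
    obtain ⟨κ, hκ, he⟩ : ∃ κ ∈ C 0, E3.enc β = E3.enc (t - u + κ) := by
      simp only [List.mem_cons, List.mem_nil_iff, or_false] at hm
      rcases hm with h | h
      · exact ⟨0, by rw [hC0]; simp, by rw [h, ← cadd_enc, enc_zero]⟩
      · exact ⟨e2, by rw [hC0]; simp, by rw [h, ← cadd_enc, enc_e2]⟩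
    have hw := word hS (i := 1) (k := 0) (j := 0) hβm hκ ht hu (by rw [enc_inj he]; abel)
    exact h10 hw.1
  have gC : ∀ {γ}, γ ∈ C 1 → (maskOf ([0, 1].flatMap fun b => (diffs g3 [0, 1] [0, 3]).map fun s => g3.sub b s)).testBit (E3.enc γ) = false := by
    intro γ hγm
    rw [Bool.eq_false_iff]; intro h
    rw [← mem_iff_maskOf, List.mem_flatMap] at h
    obtain ⟨bc, hb, hm⟩ := h
    rw [List.mem_map] at hm
    obtain ⟨sc, hs, he⟩ := hm
    obtain ⟨β, hβm, rfl⟩ := B0_codes hB0 hb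
    obtain ⟨t, ht, u, hu, rfl⟩ := S0_codes hB0 hC0 hs
    rw [sub_enc] at he
    have hw := word hS (i := 0) (k := 1) (j := 0) hβm hγm ht hu (by rw [enc_inj he.symm]; abel)
    exact h10 hw.2.1.symm
  simp only [twoOK, state0, candOK, sub_enc, cadd_enc, Bool.and_eq_true, Bool.not_eq_true', gB hβ₁, gB hβ₂, gC hγ₁, gC hγ₂, true_and]
  refine ⟨⟨⟨⟨?_, ?_⟩, ?_⟩, ?_⟩, ?_⟩
  · cases hq : Nat.beq (E3.enc (β₁ - γ₁)) (E3.enc (β₂ - γ₂)) with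
    | false => rfl
    | true => exact absurd (word hS hβ₁ hγ₁ hβ₂ hγ₂ (enc_inj (Nat.eq_of_beq_eq_true hq))).2.2.1 hβ
  · cases hq : Nat.beq (E3.enc (β₁ - γ₂)) (E3.enc (β₂ - γ₁)) with
    | false => rfl
    | true => exact absurd (word hS hβ₁ hγ₂ hβ₂ hγ₁ (enc_inj (Nat.eq_of_beq_eq_true hq))).2.2.1 hβ
  · apply beq_land_zero
    intro n hn hm
    rw [← mem_iff_maskOf] at hm
    have hdiag : ∃ t' ∈ B 1, ∃ u ∈ C 1, n = E3.enc (t' - u) := by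
      rcases mem_four hn with rfl | rfl | rfl | rfl
      · exact ⟨β₁, hβ₁, γ₁, hγ₁, rfl⟩
      · exact ⟨β₁, hβ₁, γ₂, hγ₂, rfl⟩
      · exact ⟨β₂, hβ₂, γ₁, hγ₁, rfl⟩
      · exact ⟨β₂, hβ₂, γ₂, hγ₂, rfl⟩
    obtain ⟨t', ht', u, hu, rfl⟩ := hdiag
    obtain ⟨t, ht, u', hu', e⟩ := S0_codes hB0 hC0 hm
    have hw := word hS (i := 0) (k := 0) (j := 1) ht hu' ht' hu (enc_inj e.symm)
    exact h10 hw.1.symm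
  · apply beq_land_zero
    intro n hn hm
    rw [← mem_iff_maskOf] at hn hm
    obtain ⟨κ, hκ, rfl⟩ := C0_codes hC0 hm
    have key : ∃ γa ∈ C 1, ∃ βp ∈ B 1, ∃ βq ∈ B 1, κ = γa + (βp - βq) := by
      simp only [List.mem_cons, List.mem_nil_iff, or_false] at hn
      rcases hn with h | h | h | h | h | h
      · exact ⟨γ₁, hγ₁, β₁, hβ₁, β₁, hβ₁, by rw [enc_inj h]; abel⟩
      · exact ⟨γ₂, hγ₂, β₁, hβ₁, β₁, hβ₁, by rw [enc_inj h]; abel⟩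
      · exact ⟨γ₁, hγ₁, β₂, hβ₂, β₁, hβ₁, by rw [enc_inj h]⟩
      · exact ⟨γ₁, hγ₁, β₁, hβ₁, β₂, hβ₂, by rw [enc_inj h]; abel⟩
      · exact ⟨γ₂, hγ₂, β₂, hβ₂, β₁, hβ₁, by rw [enc_inj h]⟩
      · exact ⟨γ₂, hγ₂, β₁, hβ₁, β₂, hβ₂, by rw [enc_inj h]; abel⟩
    obtain ⟨γa, hγa, βp, hβp, βq, hβq, e⟩ := key
    have hw := word hS (i := 1) (k := 0) (j := 1) hβp hκ hβq hγa (by rw [e]; abel)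
    exact h10 hw.2.1
  · apply beq_land_zero
    intro n hn hm
    rw [← mem_iff_maskOf] at hn hm
    obtain ⟨β, hβm, rfl⟩ := B0_codes hB0 hm
    have key : ∃ βa ∈ B 1, ∃ γp ∈ C 1, ∃ γq ∈ C 1, β = βa + (γp - γq) := by
      simp only [List.mem_cons, List.mem_nil_iff, or_false] at hn
      rcases hn with h | h | h | h | h | h
      · exact ⟨β₁, hβ₁, γ₁, hγ₁, γ₁, hγ₁, by rw [enc_inj h]; abel⟩
      · exact ⟨β₂, hβ₂, γ₁, hγ₁, γ₁, hγ₁, by rw [enc_inj h]; abel⟩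
      · exact ⟨β₁, hβ₁, γ₂, hγ₂, γ₁, hγ₁, by rw [enc_inj h]⟩
      · exact ⟨β₁, hβ₁, γ₁, hγ₁, γ₂, hγ₂, by rw [enc_inj h]; abel⟩
      · exact ⟨β₂, hβ₂, γ₂, hγ₂, γ₁, hγ₁, by rw [enc_inj h]⟩
      · exact ⟨β₂, hβ₂, γ₁, hγ₁, γ₂, hγ₂, by rw [enc_inj h]; abel⟩
    obtain ⟨βa, hβa, γp, hγp, γq, hγq, e⟩ := key
    have hw := word hS (i := 0) (k := 1) (j := 1) hβm hγp hβa hγq (by rw [e]; abel)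
    exact h10 hw.1.symm

end TwoBlock


end Rank3Cert

end Summit.MatrixMultiplication.OmegaCensus
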